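import Literature.Computability.Complexity.NegationElimination
import Literature.Computability.Complexity.CircuitLowerBounds
import Literature.Computability.Complexity.RossmanMonotoneCliqueSparseNoiseRelative
import Summits.PneNP.PneNP.Theses.NegLimited
import Summits.PneNP.PneNP.Theorems.NegLimitedDoorCorrelationTransfer
import Summits.PneNP.PneNP.Theorems.NegLimitedDoorAMCover
import Summits.PneNP.PneNP.Theorems.NegLimitedDoorCorrelationNegations
import Mathlib
import HarnessLib

/-!
# Route NegLimited — line `amplified-window` on the door crux: shared OBJECTS and stub STATEMENTS
(rung F-N1/p3, ROUND-11; door item `NegLimited.NeglimitedEpsLogNegationsR`, stmt-PneNP-19860)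

The objects and the six statements of pnp-ideate-p3's registered skeleton `amplified-window`
(HOME/pnp-ideate-p3/r11/amplified-window.lean, v2 sha c828757ca2bc7a67; ROUND-11.md §B; card
r11/amplified-window.md) VERBATIM, landed once so that every stub file (`stub_engineAssembly`,
`stub_slicesNP`, `stub_doorAssembly`, `stub_criticalWindow`, `stub_monotoneAmplification`) and the
skeleton itself share the SAME constants (`recMaj3`, `ampFn`, `prodWeight`, `ampLen` are local objects of
the line — re-declaring them per file would leave their identification to definitional unfolding):
* objects: `Edge`, `maj3`, `recMaj3` (recursive majority of three on `3^d` leaves), `ampFn d f`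
  (`RM3_d ⊗ f` on block inputs `(Fin d → Fin 3) × ι → Bool`), `prodWeight d D` (`D^{⊗3^d}`), `ampLen n k`
  (`3^{⌊log₃ n⌋}·n² + k`);
* statements: (T) `CorrelationNegationsTransfer` — PROVED (`transfer_holds`, from
  `NegLimitedDoor.one_le_negations_mul_corr`, p460402), (B) `CriticalWindowHardness`, (A)
  `MonotoneAmplification`, (E) `AmplifiedCliqueCorrelation`, (S) `AmplifiedCliqueSlicesNP`, (EA)
  `EngineAssembly := B → A → E`, (DA) `DoorAssembly := T → S → E → door`;
* sanity lemmas proved in the skeleton: `maj3_mono`, `maj3_not`, `recMaj3_monotone`, `recMaj3_not`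
  (self-duality), `ampFn_monotone`, `prodWeight_nonneg`, `ampLen_lt_ampLen_succ`.
The line in one sentence (p3): read the door in CORRELATION language (T) and AMPLIFY (A) a CONSTANT-error
critical-window clique hardness (B) to `(½ + ℓ^{−ε})`-hardness of `RM3 ⊗ CLIQUE` for all poly-size monotone
circuits (E), carried by an NP language (S); B (new) and A (known, XL port) are the load-bearing stubs.

HONEST FRAMING: statements and bookkeeping objects of a registered LINE on an open door item; B, A, E,
S, EA, DA are NOT proved here; FRONTIER rung F-N1 — nothing here bears on P vs NP.
-/

set_option linter.dupNamespace false -- `Summit.PneNP.PneNP.…`: summit = sub-problem name (D-0017 single-conjunct layout)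

namespace Summit.PneNP.PneNP.Theorems.NegLimitedAmplifiedWindow

open Finset Filter
open Literature.Computability.Complexity
open Summit.PneNP.PneNP.Theorems.NegLimitedDoor (massAt agreeAt)

/-! ## Objects -/

/-- Edge slots of `K_n` (the input type of `cliqueFn n k`). -/
abbrev Edge (n : ℕ) : Type := ↥(⊤ : SimpleGraph (Fin n)).edgeSet

/-- Three-bit majority. -/
def maj3 (a b c : Bool) : Bool := (a && b) || (a && c) || (b && c)

/-- Recursive majority of depth `d` on `3^d` leaves indexed by ternary strings `Fin d → Fin 3`
(the top-level branch is the first letter). -/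
def recMaj3 : (d : ℕ) → ((Fin d → Fin 3) → Bool) → Bool
  | 0, x => x default
  | d + 1, x =>
      maj3 (recMaj3 d fun w => x (Matrix.vecCons 0 w)) (recMaj3 d fun w => x (Matrix.vecCons 1 w))
        (recMaj3 d fun w => x (Matrix.vecCons 2 w))

/-- The amplified function `RM3_d ⊗ f` on `3^d` blocks of `ι`-indexed bits. -/
def ampFn {ι : Type} (d : ℕ) (f : (ι → Bool) → Bool) (x : (Fin d → Fin 3) × ι → Bool) : Bool :=
  recMaj3 d fun w => f fun i => x (w, i)

/-- The product weight `D^{⊗ 3^d}` on block inputs. -/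
def prodWeight {ι : Type} (d : ℕ) (D : (ι → Bool) → ℝ) (x : (Fin d → Fin 3) × ι → Bool) : ℝ :=
  ∏ w : Fin d → Fin 3, D fun i => x (w, i)

/-- Input length of the slice carrying `RM3_{⌊log₃ n⌋} ⊗ CLIQUE(n,k)`: `ℓ(n,k) = 3^{⌊log₃ n⌋}·n² + k`
(for `k < n` the pair `(n,k)` is decodable from `ℓ`, since `n ↦ 3^{⌊log₃ n⌋}·n²` has gaps `≥ 2n+1`). -/
def ampLen (n k : ℕ) : ℕ := 3 ^ Nat.log 3 n * (n * n) + k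

/-! ## The statements of the line -/

/-- (T) Rossman's negation-limited transfer (CCC 2015, Lemma 1.3 / 3.2) in CORRELATION × WEIGHT form:
FKG-lattice weight, balanced monotone target, every monotone circuit of size `≤ |C|` has agreement mass
`≤ (½+δ)·total` ⟹ a De Morgan circuit computing the target with `≤ t` NOT gates forces `1 ≤ (2^{t+1}−1)·2δ`. -/
def CorrelationNegationsTransfer : Prop :=
  ∀ (ι : Type) [Fintype ι] [DecidableEq ι] (μ : (ι → Bool) → ℝ), (∀ x, 0 ≤ μ x) →
    (∀ x y, μ x * μ y ≤ μ (x ⊓ y) * μ (x ⊔ y)) →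
    ∀ f : (ι → Bool) → Bool, Monotone f → massAt μ f false = massAt μ f true → 0 < massAt μ f true →
    ∀ (C : Circuit ι) (t : ℕ) (δ : ℝ), C.IsOver deMorganBasis → C.Computes f → C.negationCount ≤ t →
      (∀ M : Circuit ι, M.IsOver monotoneBasis → M.size ≤ C.size →
        agreeAt μ f M.eval ≤ (1 / 2 + δ) * (massAt μ f false + massAt μ f true)) →
      (1 : ℝ) ≤ ((2 : ℝ) ^ (t + 1) - 1) * (2 * δ)

/-- (B) CRITICAL-WINDOW HARDNESS (the new base inequality): an absolute constant `β > 0` such that for every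
exponent `c` some FIXED clique size `k = k(c)` is `β`-hard on average for size-`n^c` monotone circuits under an
exactly balanced FKG-lattice weight on the edge slots of `K_n` (the uniform mixture of a sprinkling ladder inside
the critical window), for all large `n`. -/
def CriticalWindowHardness : Prop :=
  ∃ β : ℝ, 0 < β ∧ ∀ c : ℕ, ∃ k : ℕ, 3 ≤ k ∧ ∀ᶠ n : ℕ in atTop,
    ∃ μ : (Edge n → Bool) → ℝ, (∀ x, 0 ≤ μ x) ∧ (∀ x y, μ x * μ y ≤ μ (x ⊓ y) * μ (x ⊔ y)) ∧
      massAt μ (cliqueFn n k) true = 1 / 2 ∧ massAt μ (cliqueFn n k) false = 1 / 2 ∧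
      ∀ C : Circuit (Edge n), C.IsOver monotoneBasis01 → C.size ≤ n ^ c →
        agreeAt μ (cliqueFn n k) C.eval ≤ 1 - β

/-- (A) MONOTONE HARDNESS AMPLIFICATION (Impagliazzo hard-core + O'Donnell hybrid for `RM3_d ⊗ f`, monotone
version): constant-error hardness of a balanced monotone `f` for size-`s` monotone circuits under ANY probability
weight `D` ⟹ `(½ + K·N^{-α})`-hardness of `RM3_d ⊗ f` under `D^{⊗N}`, `N = 3^d`, for monotone circuits of size
`≤ s/(K·N^e)`. -/
def MonotoneAmplification : Prop :=
  ∃ α : ℝ, 0 < α ∧ ∃ e : ℕ, ∀ β : ℝ, 0 < β → ∃ K : ℝ, 0 < K ∧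
    ∀ (ι : Type) [Fintype ι] [DecidableEq ι] (D : (ι → Bool) → ℝ) (f : (ι → Bool) → Bool) (s d : ℕ),
      (∀ x, 0 ≤ D x) → ∑ x, D x = 1 → Monotone f → massAt D f true = 1 / 2 →
      (∀ C : Circuit ι, C.IsOver monotoneBasis01 → C.size ≤ s → agreeAt D f C.eval ≤ 1 - β) →
      ∀ M : Circuit ((Fin d → Fin 3) × ι), M.IsOver monotoneBasis01 →
        (M.size : ℝ) * K * ((3 : ℝ) ^ d) ^ e ≤ s →
        agreeAt (prodWeight d D) (ampFn d f) M.eval ≤ 1 / 2 + K * ((3 : ℝ) ^ d) ^ (-α)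

/-- (E) THE ENGINE's output: `RM3_{⌊log₃ n⌋} ⊗ CLIQUE(n,k(c))` is monotone, exactly balanced and
`(½ + ℓ^{-ε})`-hard for size-`ℓ^c` monotone circuits under some FKG-lattice weight, `ℓ = ampLen n k`. -/
def AmplifiedCliqueCorrelation : Prop :=
  ∃ ε : ℝ, 0 < ε ∧ ∀ c : ℕ, ∃ k : ℕ, 3 ≤ k ∧ ∀ᶠ n : ℕ in atTop,
    Monotone (ampFn (Nat.log 3 n) (cliqueFn n k)) ∧
    ∃ ν : ((Fin (Nat.log 3 n) → Fin 3) × Edge n → Bool) → ℝ, (∀ x, 0 ≤ ν x) ∧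
      (∀ x y, ν x * ν y ≤ ν (x ⊓ y) * ν (x ⊔ y)) ∧
      massAt ν (ampFn (Nat.log 3 n) (cliqueFn n k)) true = 1 / 2 ∧
      massAt ν (ampFn (Nat.log 3 n) (cliqueFn n k)) false = 1 / 2 ∧
      ∀ M : Circuit ((Fin (Nat.log 3 n) → Fin 3) × Edge n), M.IsOver monotoneBasis01 →
        M.size ≤ ampLen n k ^ c →
        agreeAt ν (ampFn (Nat.log 3 n) (cliqueFn n k)) M.eval ≤ 1 / 2 + (ampLen n k : ℝ) ^ (-ε)

/-- (S) NP plumbing: an NP language whose slice at `ampLen n k` (`3 ≤ k < n`) is monotone and retracts onto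
`RM3_{⌊log₃ n⌋} ⊗ CLIQUE(n,k)` for negation-limited De Morgan size. -/
def AmplifiedCliqueSlicesNP : Prop :=
  ∃ L ∈ Nondeterministic.NP, ∀ n k : ℕ, 3 ≤ k → k < n →
    Monotone (L.sliceFn (ampLen n k)) ∧ ∀ b s : ℕ,
      (∀ D : Circuit ((Fin (Nat.log 3 n) → Fin 3) × Edge n), D.IsOver deMorganBasis →
        D.Computes (ampFn (Nat.log 3 n) (cliqueFn n k)) → D.negationCount ≤ b → s ≤ D.size) →
      s ≤ negLimitedSizeOver deMorganBasis b (L.sliceFn (ampLen n k))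

/-- (EA) Engine assembly: base hardness + amplification ⟹ the engine's output. -/
def EngineAssembly : Prop :=
  CriticalWindowHardness → MonotoneAmplification → AmplifiedCliqueCorrelation

/-- (DA) Door assembly: transfer + slices + engine ⟹ the door. -/
def DoorAssembly : Prop :=
  CorrelationNegationsTransfer → AmplifiedCliqueSlicesNP → AmplifiedCliqueCorrelation →
    Summit.PneNP.PneNP.Theses.NegLimited.NeglimitedEpsLogNegationsR

/-! ## Proved: (T) from the tree; sanity lemmas on the objects -/

/-- (T) is IN THE TREE (prover-2 g6: p458916 `NegLimitedDoorCorrelationTransfer` + p460402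
`NegLimitedDoorCorrelationNegations`, referee PASS 19:05Z): `NegLimitedDoor.one_le_negations_mul_corr`, whose interface is this
statement up to the `massAt`/filtered-sum dictionary (`massAt_eq_sum_filter`, `agreeAt_eq_sum_filter`). PROVED, not a stub. -/
theorem transfer_holds : CorrelationNegationsTransfer := by
  intro ι _ _ μ hμ0 hμ f hf hbal hpos C t δ hC hCf ht hcorr
  refine Summit.PneNP.PneNP.Theorems.NegLimitedDoor.one_le_negations_mul_corr μ hμ0 hμ f hf ?_ ?_ C hC t ht
    hCf δ ?_
  · rw [← Summit.PneNP.PneNP.Theorems.NegLimitedDoor.massAt_eq_sum_filter μ f true,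
      ← Summit.PneNP.PneNP.Theorems.NegLimitedDoor.massAt_eq_sum_filter μ f false]
    exact hbal.symm
  · rw [← Summit.PneNP.PneNP.Theorems.NegLimitedDoor.massAt_false_add_massAt_true μ f]
    have h0 := Summit.PneNP.PneNP.Theorems.NegLimitedDoor.massAt_nonneg hμ0 f false
    linarith
  · intro M hM hMs
    rw [← Summit.PneNP.PneNP.Theorems.NegLimitedDoor.agreeAt_eq_sum_filter μ f M.eval,
      ← Summit.PneNP.PneNP.Theorems.NegLimitedDoor.massAt_false_add_massAt_true μ f]
    exact hcorr M hM hMs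

/-- `maj3` is monotone in each argument (jointly). -/
theorem maj3_mono {a b c a' b' c' : Bool} (ha : a ≤ a') (hb : b ≤ b') (hc : c ≤ c') :
    maj3 a b c ≤ maj3 a' b' c' := by
  revert a b c a' b' c'
  decide

/-- `maj3` is self-dual. -/
theorem maj3_not (a b c : Bool) : maj3 (!a) (!b) (!c) = !maj3 a b c := by
  revert a b c
  decide

/-- Recursive majority is monotone. -/
theorem recMaj3_monotone (d : ℕ) : Monotone (recMaj3 d) := by
  induction d with
  | zero => intro x y hxy; exact hxy default
  | succ d ih =>
    intro x y hxy
    simp only [recMaj3]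
    exact maj3_mono (ih fun _ => hxy _) (ih fun _ => hxy _) (ih fun _ => hxy _)

/-- Recursive majority is self-dual: `RM3(¬x) = ¬RM3(x)`. -/
theorem recMaj3_not (d : ℕ) (x : (Fin d → Fin 3) → Bool) :
    recMaj3 d (fun w => !x w) = !recMaj3 d x := by
  induction d with
  | zero => rfl
  | succ d ih =>
    simp only [recMaj3]
    rw [← maj3_not]
    congr 1
    · exact ih fun w => x (Matrix.vecCons 0 w)
    · exact ih fun w => x (Matrix.vecCons 1 w)
    · exact ih fun w => x (Matrix.vecCons 2 w)

/-- The amplified function of a monotone `f` is monotone. -/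
theorem ampFn_monotone {ι : Type} (d : ℕ) {f : (ι → Bool) → Bool} (hf : Monotone f) :
    Monotone (ampFn d f) := by
  intro x y hxy
  exact recMaj3_monotone d fun w => hf fun i => hxy (w, i)

/-- The product weight of a nonnegative weight is nonnegative. -/
theorem prodWeight_nonneg {ι : Type} (d : ℕ) {D : (ι → Bool) → ℝ} (hD : ∀ x, 0 ≤ D x)
    (x : (Fin d → Fin 3) × ι → Bool) : 0 ≤ prodWeight d D x :=
  Finset.prod_nonneg fun _ _ => hD _

/-- `ampLen` is decodable: `n ↦ 3^{⌊log₃ n⌋}·n²` strictly dominates gaps of size `n`. -/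
theorem ampLen_lt_ampLen_succ (n k k' : ℕ) (hk : k < n + 1) : ampLen n k < ampLen (n + 1) k' := by
  unfold ampLen
  have h3 : 3 ^ Nat.log 3 n ≤ 3 ^ Nat.log 3 (n + 1) :=
    Nat.pow_le_pow_right (by norm_num) (Nat.log_mono_right (Nat.le_succ n))
  have h1 : 1 ≤ 3 ^ Nat.log 3 n := Nat.one_le_pow _ _ (by norm_num)
  nlinarith

end Summit.PneNP.PneNP.Theorems.NegLimitedAmplifiedWindow
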